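import Mathlib.Analysis.SpecialFunctions.Pow.Real
import Mathlib.Analysis.Convex.SpecificFunctions.Basic
import Literature.Probability.Percolation.FourArmGarbanProofs

/-!
# Crux `FlipErgodicityZ2` (stmt-CriticalPhenomena-14825), line `registered`, stub
# `stub_latticeSecondMoment`: the scalar bookkeeping of the second-moment computation

Route `Summits/CriticalPhenomena/CardyFormulaZ2/Theses/CardyMeckeFlip`.  Helper file (supports the
crux item).  Model-free arithmetic of the classical second-moment computation for the number of
`ε`-important edges (Garban–Pete–Schramm, JAMS 26 (2013), §4.3–4.4; Kesten 1987), isolated from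
the percolation estimates, which enter only through three abstract hypotheses on two functions
`a : ℕ → ℝ` (four-arm probability from an edge to distance `N`) and `α : ℕ → ℕ → ℝ` (four-arm
probability of the annulus `A_{r,R}`):

  (Q1) quasi-multiplicativity from the edge: `c_Q · a(m) · α(m, N) ≤ a(N)` for `N₀ ≤ m < N`;
  (Q2) quasi-multiplicativity of annuli: `α(r, ρ) α(ρ, R) ≤ C_Q α(r, R)` for `1 ≤ r ≤ ρ ≤ R`;
  (Q3) the a priori lower bound: `c_L (r/R)^{2-η} ≤ α(r, R)` for `1 ≤ r ≤ R`, with `0 ≤ η`.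

* `armAlgebra_mid` — the bound of the intermediate pair terms:
  `a(h)² α(4h, m) ≤ (16 C_Q / (c_Q² c_L²)) · a(n) a(m) · (n/h)^{2-η}`;
* `armAlgebra_ratio` — `c_Q c_L θ² a(m) ≤ a(n)` when `θ ≤ m/n ≤ 1`;
* `armAlgebra_floor` — `c_Q c_L a(N₀) ≤ n² a(n)`: the edge four-arm probability decays at most
  like `n⁻²`;
* `sum_rpow_sub_one_le` — `Σ_{ℓ=1}^{M} ℓ^{η-1} ≤ M^η / η` for `0 < η ≤ 1` (Bernoulli's inequality),
  the convergent sum behind "`E[X²] ≤ C E[X]²`";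
* counting on `ℤ²`: `card_siteSphere` (`|{‖v‖_∞ = ℓ}| = 8ℓ`), `card_filter_fst_sub_mem_le`,
  `mem_box_iff_natAbs_le`, `mem_siteSphere_iff_natAbs_eq` (sup-norm bookkeeping for the edges
  `(y, j)` at prescribed sup-distance from `x`).
-/

noncomputable section

open Finset
open Literature.Probability.Percolation Literature.Probability.LatticeModels

namespace Summit.CriticalPhenomena.CardyFormulaZ2.Theorems.CardyMeckeFlip

/-! ### A concavity sum: `Σ_{ℓ=1}^{M} ℓ^{η-1} ≤ M^η / η` -/

/-- Bernoulli: `η (M+1)^{η-1} ≤ (M+1)^η - M^η` for `0 < η ≤ 1`. [folklore] -/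
theorem mul_rpow_sub_one_le_sub {η : ℝ} (hη0 : 0 < η) (hη1 : η ≤ 1) (M : ℕ) :
    η * ((M : ℝ) + 1) ^ (η - 1) ≤ ((M : ℝ) + 1) ^ η - (M : ℝ) ^ η := by
  have hM1 : (0 : ℝ) < (M : ℝ) + 1 := by positivity
  have hs : (-1 : ℝ) ≤ -((M : ℝ) + 1)⁻¹ := by
    rw [neg_le_neg_iff]
    exact inv_le_one_of_one_le₀ (by simp)
  have hb := rpow_one_add_le_one_add_mul_self hs hη0.le hη1
  -- `(1 - 1/(M+1))^η = M^η / (M+1)^η`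
  have h1 : (1 : ℝ) + -((M : ℝ) + 1)⁻¹ = (M : ℝ) / ((M : ℝ) + 1) := by
    field_simp
    ring
  rw [h1, Real.div_rpow (by positivity) hM1.le] at hb
  rw [div_le_iff₀ (Real.rpow_pos_of_pos hM1 η)] at hb
  have h2 : ((M : ℝ) + 1) ^ (η - 1) = ((M : ℝ) + 1) ^ η * ((M : ℝ) + 1)⁻¹ := by
    rw [Real.rpow_sub_one hM1.ne', div_eq_mul_inv]
  rw [h2]
  have h3 : ((M : ℝ) + 1) ^ η * ((M : ℝ) + 1)⁻¹ * ((M : ℝ) + 1) = ((M : ℝ) + 1) ^ η := by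
    field_simp
  nlinarith [hb, Real.rpow_pos_of_pos hM1 η, h3]

/-- **`Σ_{ℓ=1}^{M} ℓ^{η-1} ≤ M^η / η`** for `0 < η ≤ 1`. [folklore] -/
theorem sum_rpow_sub_one_le :
    ∀ η : ℝ, 0 < η → η ≤ 1 →
      ∀ M : ℕ, ∑ ℓ ∈ Finset.Icc 1 M, ((ℓ : ℕ) : ℝ) ^ (η - 1) ≤ (M : ℝ) ^ η / η := by
  intro η hη0 hη1 M
  induction M with
  | zero => simp [Real.zero_rpow hη0.ne']
  | succ M ih =>
    rw [Finset.sum_Icc_succ_top (by omega), le_div_iff₀ hη0]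
    rw [le_div_iff₀ hη0] at ih
    have := mul_rpow_sub_one_le_sub hη0 hη1 M
    push_cast
    nlinarith [this, ih]

/-! ### Exponent bookkeeping -/

/-- On `(0,1]` a smaller exponent gives a larger power: `x² ≤ x^{2-η}` (`0 ≤ η`, `0 < x ≤ 1`).
[folklore] -/
theorem sq_le_rpow_two_sub {x η : ℝ} (hx0 : 0 < x) (hx1 : x ≤ 1) (hη : 0 ≤ η) :
    x ^ 2 ≤ x ^ (2 - η) := by
  have := Real.rpow_le_rpow_of_exponent_ge hx0 hx1 (show 2 - η ≤ 2 by linarith)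
  rwa [Real.rpow_two] at this

/-- `(r/R)^{s} · (R/r)^{s} = 1` for positive `r`, `R`. [folklore] -/
theorem rpow_div_mul_rpow_div {r R s : ℝ} (hr : 0 < r) (hR : 0 < R) :
    (r / R) ^ s * (R / r) ^ s = 1 := by
  rw [← Real.mul_rpow (by positivity) (by positivity), div_mul_div_comm, mul_comm r R,
    div_self (by positivity), Real.one_rpow]

/-! ### The arm algebra -/

/-- **The intermediate pair term.**  Under (Q1)–(Q3): for `1 ≤ h`, `N₀ ≤ h`, `4h ≤ m`, `h < n`,
`a(h)² α(4h, m) ≤ (16 C_Q / (c_Q² c_L²)) a(n) a(m) (n/h)^{2-η}` (GPS 2013 §4.3: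
"`E[x_i x_j] ≍ ε⁴ η⁻⁴ α₄^η(η,1)² / α₄^η(l,1)`"-type estimate, here one-sided, for bond-`ℤ²`).
[folklore] -/
theorem armAlgebra_mid {a : ℕ → ℝ} {α : ℕ → ℕ → ℝ} {N₀ : ℕ} {cQ CQ cL η : ℝ} (hcQ : 0 < cQ)
    (hCQ : 0 < CQ) (hcL : 0 < cL) (hη0 : 0 ≤ η) (ha0 : ∀ N, 0 ≤ a N)
    (hQ1 : ∀ m N : ℕ, N₀ ≤ m → m < N → cQ * (a m * α m N) ≤ a N)
    (hQ2 : ∀ r ρ R : ℕ, 1 ≤ r → r ≤ ρ → ρ ≤ R → α r ρ * α ρ R ≤ CQ * α r R)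
    (hQ3 : ∀ r R : ℕ, 1 ≤ r → r ≤ R → cL * ((r : ℝ) / R) ^ (2 - η) ≤ α r R)
    {h m n : ℕ} (hh : 1 ≤ h) (hN₀ : N₀ ≤ h) (hhm : 4 * h ≤ m) (hhn : h < n) :
    a h ^ 2 * α (4 * h) m ≤
      16 * CQ / (cQ ^ 2 * cL ^ 2) * (a n * a m) * ((n : ℝ) / h) ^ (2 - η) := by
  have hh0 : (0 : ℝ) < h := by exact_mod_cast hh
  have hn0 : (0 : ℝ) < n := by exact_mod_cast (hh.trans hhn.le)
  have hnn : ∀ r R : ℕ, 1 ≤ r → r ≤ R → 0 ≤ α r R := fun r R hr hrR =>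
    le_trans (mul_nonneg hcL.le (Real.rpow_nonneg (by positivity) _)) (hQ3 r R hr hrR)
  -- the five inputs
  have h1 := hQ1 h n hN₀ hhn
  have h2 := hQ1 h m hN₀ (by omega)
  have h3 := hQ2 h (4 * h) m hh (by omega) hhm
  have h4 : cL / 16 ≤ α h (4 * h) := by
    have := hQ3 h (4 * h) hh (by omega)
    have hq : ((h : ℕ) : ℝ) / ((4 * h : ℕ) : ℝ) = 1 / 4 := by
      push_cast; field_simp
    rw [hq] at this
    have h16 : (1 / 16 : ℝ) ≤ (1 / 4 : ℝ) ^ (2 - η) :=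
      (by norm_num : (1 / 16 : ℝ) = (1 / 4) ^ 2).le.trans
        (sq_le_rpow_two_sub (by norm_num) (by norm_num) hη0)
    calc cL / 16 = cL * (1 / 16) := by ring
      _ ≤ cL * (1 / 4 : ℝ) ^ (2 - η) := mul_le_mul_of_nonneg_left h16 hcL.le
      _ ≤ α h (4 * h) := this
  have h5 := hQ3 h n hh hhn.le
  -- positivity of the arm probabilities entering denominators
  have hPpos : 0 < ((h : ℝ) / n) ^ (2 - η) := Real.rpow_pos_of_pos (div_pos hh0 hn0) _
  have hP : 0 < α h n := lt_of_lt_of_le (mul_pos hcL hPpos) h5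
  have hA := ha0 h
  have hU := hnn (4 * h) m (by omega) hhm
  set X := a h ^ 2 * α (4 * h) m with hX
  have hX0 : 0 ≤ X := by positivity
  -- `X · c_Q² P T ≤ C_Q a(n) a(m)`
  have hprod : cQ * (a h * α h n) * (cQ * (a h * α h m)) ≤ a n * a m :=
    mul_le_mul h1 h2 (by have := hnn h m hh (by omega); positivity) (ha0 n)
  have key : X * (cQ ^ 2 * α h n * α h (4 * h)) ≤ CQ * (a n * a m) := by
    calc X * (cQ ^ 2 * α h n * α h (4 * h))
        = cQ ^ 2 * a h ^ 2 * α h n * (α h (4 * h) * α (4 * h) m) := by rw [hX]; ring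
      _ ≤ cQ ^ 2 * a h ^ 2 * α h n * (CQ * α h m) :=
          mul_le_mul_of_nonneg_left h3 (by positivity)
      _ = CQ * (cQ * (a h * α h n) * (cQ * (a h * α h m))) := by ring
      _ ≤ CQ * (a n * a m) := mul_le_mul_of_nonneg_left hprod hCQ.le
  -- lower bounds for the denominators
  have hden : cQ ^ 2 * (cL * ((h : ℝ) / n) ^ (2 - η)) * (cL / 16) ≤
      cQ ^ 2 * α h n * α h (4 * h) := by
    have := mul_le_mul h5 h4 (by positivity) hP.le
    calc cQ ^ 2 * (cL * ((h : ℝ) / n) ^ (2 - η)) * (cL / 16)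
        = cQ ^ 2 * ((cL * ((h : ℝ) / n) ^ (2 - η)) * (cL / 16)) := by ring
      _ ≤ cQ ^ 2 * (α h n * α h (4 * h)) := mul_le_mul_of_nonneg_left this (by positivity)
      _ = cQ ^ 2 * α h n * α h (4 * h) := by ring
  have key' : X * (cQ ^ 2 * (cL * ((h : ℝ) / n) ^ (2 - η)) * (cL / 16)) ≤ CQ * (a n * a m) :=
    (mul_le_mul_of_nonneg_left hden hX0).trans key
  -- solve for `X`
  have hD : 0 < cQ ^ 2 * (cL * ((h : ℝ) / n) ^ (2 - η)) * (cL / 16) := by positivity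
  rw [← le_div_iff₀ hD] at key'
  have hP' : ((n : ℝ) / h) ^ (2 - η) = (((h : ℝ) / n) ^ (2 - η))⁻¹ :=
    eq_inv_of_mul_eq_one_right (rpow_div_mul_rpow_div hh0 hn0)
  rw [hP']
  refine key'.trans (le_of_eq ?_)
  field_simp

/-- **Comparison of the edge four-arm probabilities at two scales.**  Under (Q1), (Q3): for
`1 ≤ m`, `N₀ ≤ m < n` and `0 < θ ≤ m/n`: `c_Q c_L θ² a(m) ≤ a(n)` (i.e.
`a(m) ≤ a(n) / (c_Q c_L θ²)`). [folklore] -/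
theorem armAlgebra_ratio {a : ℕ → ℝ} {α : ℕ → ℕ → ℝ} {N₀ : ℕ} {cQ cL η : ℝ} (hcQ : 0 < cQ)
    (hcL : 0 < cL) (hη0 : 0 ≤ η) (ha0 : ∀ N, 0 ≤ a N)
    (hQ1 : ∀ m N : ℕ, N₀ ≤ m → m < N → cQ * (a m * α m N) ≤ a N)
    (hQ3 : ∀ r R : ℕ, 1 ≤ r → r ≤ R → cL * ((r : ℝ) / R) ^ (2 - η) ≤ α r R)
    {m n : ℕ} (hm : 1 ≤ m) (hN₀ : N₀ ≤ m) (hmn : m < n) {θ : ℝ} (hθ0 : 0 < θ)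
    (hθ : θ ≤ (m : ℝ) / n) :
    cQ * cL * θ ^ 2 * a m ≤ a n := by
  have hm0 : (0 : ℝ) < m := by exact_mod_cast hm
  have hn0 : (0 : ℝ) < n := by exact_mod_cast (hm.trans hmn.le)
  have hq1 : (m : ℝ) / n ≤ 1 := by
    rw [div_le_one hn0]; exact_mod_cast hmn.le
  have h1 := hQ1 m n hN₀ hmn
  have h3 := hQ3 m n hm hmn.le
  have hθ2 : θ ^ 2 ≤ ((m : ℝ) / n) ^ (2 - η) :=
    (pow_le_pow_left₀ hθ0.le hθ 2).trans (sq_le_rpow_two_sub (div_pos hm0 hn0) hq1 hη0)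
  calc cQ * cL * θ ^ 2 * a m = cQ * (a m * (cL * θ ^ 2)) := by ring
    _ ≤ cQ * (a m * (cL * ((m : ℝ) / n) ^ (2 - η))) := by gcongr; exact ha0 m
    _ ≤ cQ * (a m * α m n) := by gcongr; exact ha0 m
    _ ≤ a n := h1

/-- **The edge four-arm probability decays at most like `n⁻²`.**  Under (Q1), (Q3): for
`1 ≤ N₀ < n`, `c_Q c_L a(N₀) ≤ n² a(n)`. [folklore] -/
theorem armAlgebra_floor {a : ℕ → ℝ} {α : ℕ → ℕ → ℝ} {N₀ : ℕ} {cQ cL η : ℝ} (hcQ : 0 < cQ)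
    (hcL : 0 < cL) (hη0 : 0 ≤ η) (ha0 : ∀ N, 0 ≤ a N)
    (hQ1 : ∀ m N : ℕ, N₀ ≤ m → m < N → cQ * (a m * α m N) ≤ a N)
    (hQ3 : ∀ r R : ℕ, 1 ≤ r → r ≤ R → cL * ((r : ℝ) / R) ^ (2 - η) ≤ α r R)
    {n : ℕ} (hN₀ : 1 ≤ N₀) (hn : N₀ < n) :
    cQ * cL * a N₀ ≤ (n : ℝ) ^ 2 * a n := by
  have hn0 : (0 : ℝ) < n := by exact_mod_cast (hN₀.trans hn.le)
  have hθ : (n : ℝ)⁻¹ ≤ (N₀ : ℝ) / n := by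
    rw [inv_eq_one_div]
    exact div_le_div_of_nonneg_right (by exact_mod_cast hN₀) hn0.le
  have := armAlgebra_ratio hcQ hcL hη0 ha0 hQ1 hQ3 hN₀ le_rfl hn (inv_pos.2 hn0) hθ
  have hn2 : (n : ℝ) ^ 2 * (n : ℝ)⁻¹ ^ 2 = 1 := by field_simp
  calc cQ * cL * a N₀ = (n : ℝ) ^ 2 * (cQ * cL * (n : ℝ)⁻¹ ^ 2 * a N₀) := by
        field_simp
    _ ≤ (n : ℝ) ^ 2 * a n := mul_le_mul_of_nonneg_left this (by positivity)

/-! ### Counting on `ℤ²` -/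

/-- The sup-norm ball in `natAbs` form: `v ∈ [-R,R]² ↔ max |v₀| |v₁| ≤ R`. [folklore] -/
theorem mem_box_iff_natAbs_le (v : Site 2) (R : ℕ) :
    v ∈ box 2 R ↔ max (v 0).natAbs (v 1).natAbs ≤ R := by
  simp only [mem_box, Fin.forall_fin_two, max_le_iff]
  omega

/-- The sup-norm sphere in `natAbs` form (`R ≥ 1`): `v ∈ siteSphere R ↔ max |v₀| |v₁| = R`.
[folklore] -/
theorem mem_siteSphere_iff_natAbs_eq (v : Site 2) {R : ℕ} (hR : 1 ≤ R) :
    v ∈ siteSphere R ↔ max (v 0).natAbs (v 1).natAbs = R := by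
  rw [siteSphere, Finset.mem_sdiff, mem_box_iff_natAbs_le, mem_box_iff_natAbs_le]
  omega

/-- **`|{v ∈ ℤ² : ‖v‖_∞ = ℓ}| = 8ℓ`** for `ℓ ≥ 1`. [folklore] -/
theorem card_siteSphere {ℓ : ℕ} (hℓ : 1 ≤ ℓ) : (siteSphere ℓ).card = 8 * ℓ := by
  obtain ⟨k, rfl⟩ : ∃ k, ℓ = k + 1 := ⟨ℓ - 1, by omega⟩
  rw [siteSphere, Finset.card_sdiff, Finset.inter_eq_left.2 (box_mono 2 (by omega)), card_box,
    card_box, Nat.add_sub_cancel]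
  have : (2 * (k + 1) + 1) ^ 2 = 8 * (k + 1) + (2 * k + 1) ^ 2 := by ring
  omega

/-- Edges `(y, j)` with `y - x` in a prescribed finite set `F`: at most `2 |F|` of them in any
finite set of edges. [folklore] -/
theorem card_filter_fst_sub_mem_le (E : Finset (Site 2 × Fin 2)) (x : Site 2) (F : Finset (Site 2)) :
    (E.filter fun q => q.1 - x ∈ F).card ≤ 2 * F.card := by
  classical
  calc (E.filter fun q => q.1 - x ∈ F).card
      ≤ (F ×ˢ (Finset.univ : Finset (Fin 2))).card := by
        refine Finset.card_le_card_of_injOn (fun q => (q.1 - x, q.2)) (fun q hq => ?_)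
          (fun q₁ hq₁ q₂ hq₂ h => ?_)
        · rw [Finset.coe_filter] at hq
          simp only [Finset.coe_product, Finset.coe_univ, Set.mem_prod, Finset.mem_coe,
            Set.mem_univ, and_true]
          exact hq.2
        · simp only [Prod.mk.injEq, sub_left_inj] at h
          exact Prod.ext h.1 h.2
    _ = 2 * F.card := by rw [Finset.card_product, Finset.card_univ, Fintype.card_fin, mul_comm]

end Summit.CriticalPhenomena.CardyFormulaZ2.Theorems.CardyMeckeFlip

end
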